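import Summits.AtomisticToContinuum.Crystallization.Theses.DisclinationRation
import Summits.AtomisticToContinuum.Crystallization.Theorems.GscTwinLoopSurgeryLocalLimitStable
import Summits.AtomisticToContinuum.Crystallization.Theorems.DisclinationRationAlphabetGoodHullElementStubAlphabetGoodRelDense
import Literature.MathematicalPhysics.StatisticalMechanics.HardCoreGSC
import HarnessLib

/-!
# Line `census-liouville` — STRATEGIST ALTERNATIVE LINE for crux `AlphabetGoodHullElement`
# (item stmt-AtomisticToContinuum-15798, route `DisclinationRation`, K1, rank 2)

Registered ALONGSIDE the live skeleton `Lines/birth.lean` (never overwriting it; stubs added with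
`workitem stub-add`).  Source ideas: `Ideas/strain-blind-census-rung.md` + `Ideas/equilibrium-shape-liouville.md`
(crux-ideate r1, ideator 1), re-typed here over existing declarations with a LIMIT-STABLE census.

Crux (concluded BY NAME below): every sequence of Lennard-Jones ground states in `ℝ³` has a
`δ`-separated, relatively dense hull element `S ∋ 0` all of whose sites are alphabet-good (`GA`:
strict `13/10·d_y` shell `1/20`-matched to fcc / hcp / the decahedral-axis pattern).

## The line: PRICE TOPOLOGY, NOT SHAPE — then EXACTIFY — then RIGIDITY OF THE ZERO-STRESS HULL

The birth line puts the whole open content into ONE energetic stub about the SHAPE predicate `GA`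
(tolerance `1/20`), whose cheapest violators are sub-percent elastic distortions of close packings
(hcp layer shuffle `s = 0.04a`: all sites `GA`-bad at `3.2e-3`/site = `0.44 %·|e*|`; NUMERICS-ideator1).
This line asks the energy only a TOPOLOGICAL question and moves the shape to an `e*`-free rigidity
statement about zero-stress equilibria:

* `CC S y` — the WIDE-WINDOW LINK CENSUS of a site (scale-free; = the per-site common-neighbour
  signature of Honeycutt–Andersen with an adaptive cutoff): with `d = d_y` the nearest-neighbour distance,
  the closed window `T = {z ∈ S : 0 < |z - y| ≤ 61/50·d}` holds EXACTLY twelve points, the buffer annulus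
  `(61/50·d, 13/10·d)` holds NO point of `S` (this empty buffer is what makes cleanliness pass to local
  limits — a single-threshold count never does), every bond `(y,z)`, `z ∈ T`, has ring number
  `#{w ∈ T : 0 < |w - z| ≤ 61/50·d_z} ∈ {4, 5}`, and the number of five-ring bonds is `0` or `2`.
  Clean letters: fcc `(12; 4¹²)`, hcp `(12; 4¹²)`, decahedral-axis site `(12; 4¹⁰5²)`; dirty: icosahedral
  centre `(12; 5¹²)`, bcc/bct `(14; …)`, Frank–Kasper Z14–16, vacancy neighbours (11), anything strained
  far beyond the elastic regime (computed: simple shear ≥ 25 %, bct c/a ≤ 1.2 on the Bain path, where a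
  `√2·d` neighbour enters the buffer).  The census is blind to every elastic distortion of a close packing
  (checked clean: shear ≤ 20 %, uniaxial ≤ 20 %, hcp c/a ∈ [1.40, 1.85], layer shuffles ≤ 0.10·a).
* `stub_censusDefectsVanish` (XL; ENERGY — the load-bearing open stub): along LJ ground states the
  fraction of census-dirty particles tends to `0`.  Cheapest dirty competitors (kit j025175, 652 zero-stress
  relaxations, n ≤ 8/cell; lattice sums VETTING.md): defective close packings with 11-counted sites at
  `+2.57e-2 = 3.59 %·|e*|`, bct-Bain `4.06 %`, bcc `4.3 %` (Born-unstable), σ `7.8 %`, A15 `12 %`, C15 `18 %` —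
  margin ≈ 8× the shape predicate's `0.44 %`.  Still the coarse crystal problem (in census currency).
* `stub_censusCleanHullElement` (M; compactness) — exactification no. 1 for the census predicate, the
  pattern of the PROVED `hullGoodEverywhere_proof` (stmt-12089) / `hullExactShells_proof` (12092): clean
  balls by pigeonhole, recentring, local limit, and cleanliness passes to the limit because the inner
  window is closed and the buffer open and empty at every site of the clean ball; scale bound from
  `hge_exists_bond_radius`.
* `stub_hullZeroMeanStress` (M/L; NEW, serves K3 `BarlowLiouville` too) — hull elements of ground states
  have ZERO MEAN STRESS on large balls: the first variation of the ball site-sum under every affine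
  motion `y ↦ y + tAy` is `o(L³)` uniformly in the centre.  Plan: `hullBulkOptimal_proof` (ball site-sums
  `≤ 2e∞·# + εL³`) against the competitor bound for the affinely deformed ball (`≥ 2e∞·# − CL²`,
  pattern of `hullEnergyLowerBound_proof` / `card_mul_eStar_le`), second `t`-derivative `≤ CL³`
  (separation), optimise `t ~ √ε`.
* (proved in this file, not a stub) hull elements are hard-core canonical GSCs: `localLimitStable_proof`
  (stmt-14086) repackaged as `IsHardCoreGSC`.
* `stub_cleanEquilibriumAlphabetGood` (XL; the `e*`-FREE multiwell Liouville statement C⁺) — a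
  `δ`-separated set with bounded scale that is EVERYWHERE census-clean, a hard-core GSC for `V_LJ` and
  has zero mean stress is everywhere alphabet-good.  The census fixes the combinatorics (link =
  cuboctahedron / anticuboctahedron / bicapped pentagonal prism; cf. the landed tolerance-free
  `stub_combClassification` of `Cruxes/ZeroDefectDensity`), so the set is a ≤ 8 % bi-Lipschitz image of a
  Barlow / parallel-axis template; GSC minimality kills frozen optical distortions (jitterbug twists,
  shuffles), zero mean stress kills uniform deviatoric strain at once (a 6 % volume-preserving uniaxial
  stretch of fcc is census-clean — the census tolerates ≈ 20 % stretch / shear, table in the line card —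
  and `GA`-bad (deviation 0.064 > 1/20); GSC minimality excludes it only through a large-scale
  re-nucleation argument), and same-sign wedge disclinations have log-divergent
  stress in an infinite zero-mean-stress equilibrium, so only stress-free twins survive — FJM rigidity +
  discrete Caccioppoli / unique continuation (landed HcpLiouville files) + the route's K4.
* (LANDED, imported — not a stub) relative denseness of everywhere-alphabet-good sets with bounded scale:
  the birth line's stub 3 `AlphabetGoodHullElementBirth.stub_alphabetGoodRelDense` (p166512).

`AlphabetGoodHullElement_of` is the kernel-checked composition (B ∘ A gives the clean hull element with
scale bound; in-file GSC lemma + C give the equilibrium package; D gives `GA` everywhere; E relative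
denseness by the landed birth stub 3).  The ONLY `sorry`s of this file are the four `stub_*`.

Disproof.lean (cdisprove cycle 1, 2026-08-17): `alphabetGoodHullElement_false_without_minimality` /
`_false_for_zero_potential` — minimality and cohesion are used at stub A (landscape), stub C (bulk
optimality) and stub D (`IsHardCoreGSC`); §2 `∃S ↦ ∀S` refuted by FLAT hull elements
(`Negative/FlatHullElement`, `Negative/RootNotGood`) — B concludes `∃ S` with CHOSEN centres, D's
hypothesis `everywhere census-clean` excludes every flat / surface-carrying set (surface sites are
11-counted or worse), and C holds on flat hull elements too (surface stress is `O(L²) = o(L³)`).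
Negatives honoured: 17253 (dilation
family) — every predicate here is scale-free and `D` assumes zero mean stress; 4146 / 15929 (D₅ₕ shell,
torn icosahedron) — no pattern is inferred from a count: `A` is an energy statement about ground states,
`D` assumes the full census EVERYWHERE plus equilibrium, and D₅ₕ is a clean letter by design; 3506 n/a.
-/

noncomputable section

namespace Summit.AtomisticToContinuum.Crystallization.Cruxes.AlphabetGoodHullElement.CensusLiouville

/-! ## Registered stubs (the ONLY `sorry`s of the file; one-line, fully qualified signatures) -/

/-- **STUB A — census defects vanish** (XL; energy; load-bearing).  Along every sequence of
Lennard-Jones ground states in `ℝ³` the fraction of census-DIRTY particles (wide-window link census `CC`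
of the module docstring, evaluated in `Set.range (x N)`) tends to `0`.  Why it might fail: a census-dirty
bulk phase within `o(1)`/particle of `e*` (none known: floor `+3.59 %·|e*|` in kit j025175; bcc `4.3 %`,
σ `7.8 %`, A15 `12 %`), or no provable landscape bound for 12-6 at percent resolution (the coarse crystal
problem; barrier `LocalizedPotentialsExcludeLennardJones`). -/
theorem stub_censusDefectsVanish : let CC : Set (EuclideanSpace ℝ (Fin 3)) → EuclideanSpace ℝ (Fin 3) → Prop := fun S y => let d : ℝ := sInf ((fun z => dist z y) '' (S \ {y})); let T : Set (EuclideanSpace ℝ (Fin 3)) := {z : EuclideanSpace ℝ (Fin 3) | z ∈ S ∧ z ≠ y ∧ dist z y ≤ 61 / 50 * d}; (∀ z ∈ S, dist z y ≤ 61 / 50 * d ∨ 13 / 10 * d ≤ dist z y) ∧ T.ncard = 12 ∧ (∀ z ∈ T, ({w : EuclideanSpace ℝ (Fin 3) | w ∈ T ∧ w ≠ z ∧ dist w z ≤ 61 / 50 * sInf ((fun v => dist v z) '' (S \ {z}))} : Set (EuclideanSpace ℝ (Fin 3))).ncard = 4 ∨ ({w : EuclideanSpace ℝ (Fin 3) |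 w ∈ T ∧ w ≠ z ∧ dist w z ≤ 61 / 50 * sInf ((fun v => dist v z) '' (S \ {z}))} : Set (EuclideanSpace ℝ (Fin 3))).ncard = 5) ∧ (({z : EuclideanSpace ℝ (Fin 3) | z ∈ T ∧ ({w : EuclideanSpace ℝ (Fin 3) | w ∈ T ∧ w ≠ z ∧ dist w z ≤ 61 / 50 * sInf ((fun v => dist v z) '' (S \ {z}))} : Set (EuclideanSpace ℝ (Fin 3))).ncard = 5} : Set (EuclideanSpace ℝ (Fin 3))).ncard = 0 ∨ ({z : EuclideanSpace ℝ (Fin 3) | z ∈ T ∧ ({w : EuclideanSpace ℝ (Fin 3) | w ∈ T ∧ w ≠ z ∧ dist w z ≤ 61 / 50 * sInf ((fun v => dist v z) '' (S \ {z}))} : Set (EuclideanSpace ℝ (Fin 3))).ncard = 5} : Set (EuclideanSpace ℝ (Fin 3))).ncard = 2); ∀ (x : (N : ℕ) → (Fin N → EuclideanSpace ℝ (Fin 3))), (∀ N, Literature.MathematicalPhysics.StatisticalMechanics.IsGroundState Literature.MathematicalPhysics.StatisticalMechanics.lennardJones (x N)) → Filter.Tendsto (fun N : ℕ => (Nat.card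 {i : Fin N // ¬ CC (Set.range (x N)) (x N i)} : ℝ) / (N : ℝ)) Filter.atTop (nhds (0 : ℝ)) := by
  sorry

/-- **STUB B — census-clean hull element with bounded scale** (M; compactness; exactification no. 1
for the census predicate, pattern of the PROVED `hullGoodEverywhere_proof` stmt-12089).  If the
census-dirty fraction tends to `0`, some hull element `S ∋ 0` (two-way matching of translates along a
subsequence on every ball) is `δ`-separated and EVERY `y ∈ S` is census-clean with local scale `≤ R₀`.
Limit-stability of `CC`: closed inner window, open empty buffer, at every site of a clean ball. -/
theorem stub_censusCleanHullElement : let CC : Set (EuclideanSpace ℝ (Fin 3)) → EuclideanSpace ℝ (Fin 3) → Prop := fun S y => let d : ℝ := sInf ((fun z => dist z y) '' (S \ {y})); let T : Set (EuclideanSpace ℝ (Fin 3)) := {z : EuclideanSpace ℝ (Fin 3) | z ∈ S ∧ z ≠ y ∧ dist z y ≤ 61 / 50 * d}; (∀ z ∈ S, dist z y ≤ 61 / 50 * d ∨ 13 / 10 * d ≤ dist z y) ∧ T.ncard = 12 ∧ (∀ z ∈ T, ({w : EuclideanSpace ℝ (Fin 3) | w ∈ T ∧ w ≠ z ∧ dist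 w z ≤ 61 / 50 * sInf ((fun v => dist v z) '' (S \ {z}))} : Set (EuclideanSpace ℝ (Fin 3))).ncard = 4 ∨ ({w : EuclideanSpace ℝ (Fin 3) | w ∈ T ∧ w ≠ z ∧ dist w z ≤ 61 / 50 * sInf ((fun v => dist v z) '' (S \ {z}))} : Set (EuclideanSpace ℝ (Fin 3))).ncard = 5) ∧ (({z : EuclideanSpace ℝ (Fin 3) | z ∈ T ∧ ({w : EuclideanSpace ℝ (Fin 3) | w ∈ T ∧ w ≠ z ∧ dist w z ≤ 61 / 50 * sInf ((fun v => dist v z) '' (S \ {z}))} : Set (EuclideanSpace ℝ (Fin 3))).ncard = 5} : Set (EuclideanSpace ℝ (Fin 3))).ncard = 0 ∨ ({z : EuclideanSpace ℝ (Fin 3) | z ∈ T ∧ ({w : EuclideanSpace ℝ (Fin 3) | w ∈ T ∧ w ≠ z ∧ dist w z ≤ 61 / 50 * sInf ((fun v => dist v z) '' (S \ {z}))} : Set (EuclideanSpace ℝ (Fin 3))).ncard = 5} : Set (EuclideanSpace ℝ (Fin 3))).ncard = 2); let HL : ((N : ℕ) → (Fin N → EuclideanSpace ℝ (Fin 3)))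 → Set (EuclideanSpace ℝ (Fin 3)) → Prop := fun x S => ∃ φ : ℕ → ℕ, StrictMono φ ∧ ∃ τ : ℕ → EuclideanSpace ℝ (Fin 3), ∀ R ε : ℝ, 0 < ε → ∀ᶠ j : ℕ in Filter.atTop, (∀ s ∈ S, ‖s‖ ≤ R → ∃ i : Fin (φ j), dist (x (φ j) i + τ j) s ≤ ε) ∧ (∀ i : Fin (φ j), ‖x (φ j) i + τ j‖ ≤ R → ∃ s ∈ S, dist (x (φ j) i + τ j) s ≤ ε); ∀ (x : (N : ℕ) → (Fin N → EuclideanSpace ℝ (Fin 3))), (∀ N, Literature.MathematicalPhysics.StatisticalMechanics.IsGroundState Literature.MathematicalPhysics.StatisticalMechanics.lennardJones (x N)) → Filter.Tendsto (fun N : ℕ => (Nat.card {i : Fin N // ¬ CC (Set.range (x N)) (x N i)} : ℝ) / (N : ℝ)) Filter.atTop (nhds (0 : ℝ)) → ∃ S : Set (EuclideanSpace ℝ (Fin 3)), ∃ δ R₀ : ℝ, 0 < δ ∧ (∀ y ∈ S, ∀ z ∈ S, y ≠ z → δ ≤ dist y z) ∧ (0 : EuclideanSpace ℝ (Fin 3))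 ∈ S ∧ HL x S ∧ (∀ y ∈ S, CC S y ∧ sInf ((fun z => dist z y) '' (S \ {y})) ≤ R₀) := by
  sorry

/-- **STUB C — hull elements have zero mean stress** (M/L; new; also the first step of K3
`BarlowLiouville`).  For a hull element `S` of a sequence of LJ ground states, the first variation of the
ball site-sum `Σ_{y ∈ S ∩ B̄_L(c)} Σ'_{z ≠ y} V(|y − z|)` under `y ↦ y + tAy` (`A` any linear map) is
`≤ θL³` in absolute value for `L ≥ L₀(A, θ)`, uniformly in `c`.  Plan: `hullBulkOptimal_proof` vs the
competitor lower bound for the deformed ball, second derivative `O(L³)`, `t ~ √ε`. -/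
theorem stub_hullZeroMeanStress : let HL : ((N : ℕ) → (Fin N → EuclideanSpace ℝ (Fin 3))) → Set (EuclideanSpace ℝ (Fin 3)) → Prop := fun x S => ∃ φ : ℕ → ℕ, StrictMono φ ∧ ∃ τ : ℕ → EuclideanSpace ℝ (Fin 3), ∀ R ε : ℝ, 0 < ε → ∀ᶠ j : ℕ in Filter.atTop, (∀ s ∈ S, ‖s‖ ≤ R → ∃ i : Fin (φ j), dist (x (φ j) i + τ j) s ≤ ε) ∧ (∀ i : Fin (φ j), ‖x (φ j) i + τ j‖ ≤ R → ∃ s ∈ S, dist (x (φ j) i + τ j) s ≤ ε); let ZMS : Set (EuclideanSpace ℝ (Fin 3)) → Prop := fun S => ∀ A : EuclideanSpace ℝ (Fin 3) →L[ℝ] EuclideanSpace ℝ (Fin 3), ∀ θ : ℝ, 0 < θ → ∃ L₀ : ℝ, ∀ L : ℝ, L₀ ≤ L → ∀ c : EuclideanSpace ℝ (Fin 3), |∑' y : ↥{y : EuclideanSpace ℝ (Fin 3) | y ∈ S ∧ dist y c ≤ L}, (∑' z : ↥{z : EuclideanSpace ℝ (Fin 3) | z ∈ S ∧ z ≠ (y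 : EuclideanSpace ℝ (Fin 3))}, deriv Literature.MathematicalPhysics.StatisticalMechanics.lennardJones (dist (y : EuclideanSpace ℝ (Fin 3)) (z : EuclideanSpace ℝ (Fin 3))) / dist (y : EuclideanSpace ℝ (Fin 3)) (z : EuclideanSpace ℝ (Fin 3)) * inner ℝ ((y : EuclideanSpace ℝ (Fin 3)) - (z : EuclideanSpace ℝ (Fin 3))) (A ((y : EuclideanSpace ℝ (Fin 3)) - (z : EuclideanSpace ℝ (Fin 3)))))| ≤ θ * L ^ 3; ∀ (x : (N : ℕ) → (Fin N → EuclideanSpace ℝ (Fin 3))), (∀ N, Literature.MathematicalPhysics.StatisticalMechanics.IsGroundState Literature.MathematicalPhysics.StatisticalMechanics.lennardJones (x N)) → ∀ (S : Set (EuclideanSpace ℝ (Fin 3))) (δ : ℝ), 0 < δ → (∀ y ∈ S, ∀ z ∈ S, y ≠ z → δ ≤ dist y z) → HL x S → ZMS S := by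
  sorry

/-- **STUB D — clean zero-stress equilibria are alphabet-good** (XL; the `e*`-free multiwell
Liouville / rigidity statement).  A nonempty `δ`-separated `S ⊆ ℝ³` every site of which is census-clean
with scale `≤ R₀`, which is a hard-core canonical GSC for `V_LJ` (`IsHardCoreGSC`, Sütő 2011 §7) and has
zero mean stress on balls, is EVERYWHERE alphabet-good (`GA` of the crux, verbatim).  Why it might fail:
an exotic census-clean link realised by an equilibrium; screened disclination arrangements holding
5–8 % strain at zero mean stress; a static census-clean modulation of a Barlow stacking that is a GSC. -/
theorem stub_cleanEquilibriumAlphabetGood : let GA : Set (EuclideanSpace ℝ (Fin 3)) → EuclideanSpace ℝ (Fin 3) → Prop := fun S y => let d : ℝ := sInf ((fun z => dist z y) '' (S \ {y})); let T : Set (EuclideanSpace ℝ (Fin 3)) := {z : EuclideanSpace ℝ (Fin 3) | z ∈ S ∧ z ≠ y ∧ dist z y < 13 / 10 * d}; ∃ A : EuclideanSpace ℝ (Fin 3) →ₗᵢ[ℝ] EuclideanSpace ℝ (Fin 3), (∃ e : ↥T ≃ ↥Literature.Geometry.DiscreteGeometry.fccKissingPattern, ∀ t : ↥T, dist (d⁻¹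 • ((t : EuclideanSpace ℝ (Fin 3)) - y)) (A ((e t : ↥Literature.Geometry.DiscreteGeometry.fccKissingPattern) : EuclideanSpace ℝ (Fin 3))) ≤ 1 / 20) ∨ (∃ e : ↥T ≃ ↥Literature.Geometry.DiscreteGeometry.hcpKissingPattern, ∀ t : ↥T, dist (d⁻¹ • ((t : EuclideanSpace ℝ (Fin 3)) - y)) (A ((e t : ↥Literature.Geometry.DiscreteGeometry.hcpKissingPattern) : EuclideanSpace ℝ (Fin 3))) ≤ 1 / 20) ∨ (∃ e : ↥T ≃ ↥{p : EuclideanSpace ℝ (Fin 3) | p = !₂[(0 : ℝ), 0, 1] ∨ p = !₂[(0 : ℝ), 0, -1] ∨ ∃ k : Fin 5, ∃ σ : ℝ, (σ = 1 / 2 ∨ σ = -(1 / 2)) ∧ p = !₂[Real.sqrt 3 / 2 * Real.cos (2 * Real.pi * (k : ℝ) / 5), Real.sqrt 3 / 2 * Real.sin (2 * Real.pi * (k : ℝ) / 5), σ]}, ∀ t : ↥T, dist (d⁻¹ • ((t : EuclideanSpace ℝ (Fin 3)) - y)) (A ((e t : ↥{p : EuclideanSpace ℝ (Fin 3) | p =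 !₂[(0 : ℝ), 0, 1] ∨ p = !₂[(0 : ℝ), 0, -1] ∨ ∃ k : Fin 5, ∃ σ : ℝ, (σ = 1 / 2 ∨ σ = -(1 / 2)) ∧ p = !₂[Real.sqrt 3 / 2 * Real.cos (2 * Real.pi * (k : ℝ) / 5), Real.sqrt 3 / 2 * Real.sin (2 * Real.pi * (k : ℝ) / 5), σ]}) : EuclideanSpace ℝ (Fin 3))) ≤ 1 / 20); let CC : Set (EuclideanSpace ℝ (Fin 3)) → EuclideanSpace ℝ (Fin 3) → Prop := fun S y => let d : ℝ := sInf ((fun z => dist z y) '' (S \ {y})); let T : Set (EuclideanSpace ℝ (Fin 3)) := {z : EuclideanSpace ℝ (Fin 3) | z ∈ S ∧ z ≠ y ∧ dist z y ≤ 61 / 50 * d}; (∀ z ∈ S, dist z y ≤ 61 / 50 * d ∨ 13 / 10 * d ≤ dist z y) ∧ T.ncard = 12 ∧ (∀ z ∈ T, ({w : EuclideanSpace ℝ (Fin 3) | w ∈ T ∧ w ≠ z ∧ dist w z ≤ 61 / 50 * sInf ((fun v => dist v z) '' (S \ {z}))} : Set (EuclideanSpace ℝ (Fin 3))).ncard =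 4 ∨ ({w : EuclideanSpace ℝ (Fin 3) | w ∈ T ∧ w ≠ z ∧ dist w z ≤ 61 / 50 * sInf ((fun v => dist v z) '' (S \ {z}))} : Set (EuclideanSpace ℝ (Fin 3))).ncard = 5) ∧ (({z : EuclideanSpace ℝ (Fin 3) | z ∈ T ∧ ({w : EuclideanSpace ℝ (Fin 3) | w ∈ T ∧ w ≠ z ∧ dist w z ≤ 61 / 50 * sInf ((fun v => dist v z) '' (S \ {z}))} : Set (EuclideanSpace ℝ (Fin 3))).ncard = 5} : Set (EuclideanSpace ℝ (Fin 3))).ncard = 0 ∨ ({z : EuclideanSpace ℝ (Fin 3) | z ∈ T ∧ ({w : EuclideanSpace ℝ (Fin 3) | w ∈ T ∧ w ≠ z ∧ dist w z ≤ 61 / 50 * sInf ((fun v => dist v z) '' (S \ {z}))} : Set (EuclideanSpace ℝ (Fin 3))).ncard = 5} : Set (EuclideanSpace ℝ (Fin 3))).ncard = 2); let ZMS : Set (EuclideanSpace ℝ (Fin 3)) → Prop := fun S => ∀ A : EuclideanSpace ℝ (Fin 3) →L[ℝ] EuclideanSpace ℝ (Fin 3), ∀ θ : ℝ, 0 < θ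 → ∃ L₀ : ℝ, ∀ L : ℝ, L₀ ≤ L → ∀ c : EuclideanSpace ℝ (Fin 3), |∑' y : ↥{y : EuclideanSpace ℝ (Fin 3) | y ∈ S ∧ dist y c ≤ L}, (∑' z : ↥{z : EuclideanSpace ℝ (Fin 3) | z ∈ S ∧ z ≠ (y : EuclideanSpace ℝ (Fin 3))}, deriv Literature.MathematicalPhysics.StatisticalMechanics.lennardJones (dist (y : EuclideanSpace ℝ (Fin 3)) (z : EuclideanSpace ℝ (Fin 3))) / dist (y : EuclideanSpace ℝ (Fin 3)) (z : EuclideanSpace ℝ (Fin 3)) * inner ℝ ((y : EuclideanSpace ℝ (Fin 3)) - (z : EuclideanSpace ℝ (Fin 3))) (A ((y : EuclideanSpace ℝ (Fin 3)) - (z : EuclideanSpace ℝ (Fin 3)))))| ≤ θ * L ^ 3; ∀ (δ R₀ : ℝ) (S : Set (EuclideanSpace ℝ (Fin 3))), 0 < δ → (∀ y ∈ S, ∀ z ∈ S, y ≠ z → δ ≤ dist y z) → S.Nonempty → (∀ y ∈ S, CC S y ∧ sInf ((fun z => dist z y) '' (S \ {y})) ≤ R₀) → Literature.MathematicalPhysics.StatisticalMechanics.IsHardCoreGSC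 Literature.MathematicalPhysics.StatisticalMechanics.lennardJones S → ZMS S → ∀ y ∈ S, GA S y := by
  sorry

/-! ## Proved plumbing: hull elements are hard-core canonical GSCs (stmt-14086, landed) -/

/-- Hull elements of Lennard-Jones ground-state sequences (the crux's `HL` clause) are hard-core
canonical GSCs — `localLimitStable_proof` (stmt-AtomisticToContinuum-14086) read through
`IsHardCoreGSC` (`Iff.rfl`). [folklore] -/
theorem isHardCoreGSC_of_hull : let HL : ((N : ℕ) → (Fin N → EuclideanSpace ℝ (Fin 3))) → Set (EuclideanSpace ℝ (Fin 3)) → Prop := fun x S => ∃ φ : ℕ → ℕ, StrictMono φ ∧ ∃ τ : ℕ → EuclideanSpace ℝ (Fin 3), ∀ R ε : ℝ, 0 < ε → ∀ᶠ j : ℕ in Filter.atTop, (∀ s ∈ S, ‖s‖ ≤ R → ∃ i : Fin (φ j), dist (x (φ j) i + τ j) s ≤ ε) ∧ (∀ i : Fin (φ j), ‖x (φ j) i + τ j‖ ≤ R → ∃ s ∈ S, dist (x (φ j) i + τ j) s ≤ ε); ∀ (x : (N : ℕ) → (Fin N → EuclideanSpace ℝ (Fin 3))), (∀ N, Literature.MathematicalPhysics.StatisticalMechanics.IsGroundState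 Literature.MathematicalPhysics.StatisticalMechanics.lennardJones (x N)) → ∀ S : Set (EuclideanSpace ℝ (Fin 3)), HL x S → Literature.MathematicalPhysics.StatisticalMechanics.IsHardCoreGSC Literature.MathematicalPhysics.StatisticalMechanics.lennardJones S := by
  intro HL x hx S hS
  obtain ⟨φ, hφ, τ, hm⟩ := hS
  exact Summit.AtomisticToContinuum.Crystallization.Theorems.LocalLimitStable.localLimitStable_proof S
    ⟨x, φ, τ, hx, hφ, hm⟩

/-! ## Composition (kernel-checked): the stubs imply the crux BY NAME -/

/-- THE SKELETON THEOREM: `AlphabetGoodHullElement` from stubs A–D, the landed GSC lemma and the landed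
birth stub 3 (relative denseness). -/
theorem AlphabetGoodHullElement_of : Summit.AtomisticToContinuum.Crystallization.Theses.DisclinationRation.AlphabetGoodHullElement := by
  intro x hx
  obtain ⟨S, δ, R₀, hδ, hsep, h0, hHL, hcc⟩ :=
    stub_censusCleanHullElement x hx (stub_censusDefectsVanish x hx)
  have hZ := stub_hullZeroMeanStress x hx S δ hδ hsep hHL
  have hG := isHardCoreGSC_of_hull x hx S hHL
  have hgood := stub_cleanEquilibriumAlphabetGood δ R₀ S hδ hsep ⟨0, h0⟩ hcc hG hZ
  exact ⟨S, δ, hδ, hsep, h0, hHL, hgood,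
    Summit.AtomisticToContinuum.Crystallization.Theorems.AlphabetGoodHullElementBirth.stub_alphabetGoodRelDense
      δ R₀ S hδ hsep ⟨0, h0⟩ (fun y hy => ⟨hgood y hy, (hcc y hy).2⟩)⟩

end Summit.AtomisticToContinuum.Crystallization.Cruxes.AlphabetGoodHullElement.CensusLiouville

end
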